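import Summits.CriticalPhenomena.PercolationContinuityZ3.Theorems.Transplant.FKConnectivityAllQAntipodalOneSumClosure
import HarnessLib

/-!
# Connectivity correlation inequalities for `φ_{w,q}`, every `q > 0` — file 76b: **THE PIVOT SPLIT** — lowering or raising one coordinate of the test
# function changes the levelwise antipodal sum by an explicit one-signed-factor boundary term

Support file (`--supports stmt-CriticalPhenomena-4575`), FK sub-lane `prim-bschramm-fk-2` (gen 34); builds on p205010 (kernel theorem, internal audit
signed; external expert review pending).  No definitions, no named facts, no sorries; standard axioms.

For a cell `(M, C)`, any `f, g : Finset (Sym2 V) → ℝ`, any cut-off `J` and any pair `e`, with `f̂(γ) = f(γ∪C) − f((M∖γ)∪C)` and likewise `ĝ`: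
* **`FK.levels_sum_eq_lower_add`**: `Σ_{ℓ(γ)≤J} f̂ ĝ = Σ_{ℓ(γ)≤J} f̂_↓ ĝ + 2 Σ_{ℓ(γ)≤J} (f(γ∪C) − f((γ∪C)∖{e}))·ĝ(γ)`, where `f_↓ = f ∘ (· ∖ {e})` (`e` LOWERED);
* **`FK.levels_sum_eq_raise_sub`**: `Σ_{ℓ(γ)≤J} f̂ ĝ = Σ_{ℓ(γ)≤J} f̂_↑ ĝ − 2 Σ_{ℓ(γ)≤J} (f(insert e (γ∪C)) − f(γ∪C))·ĝ(γ)`, `f_↑ = f ∘ insert e` (`e` RAISED).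
Both are exact identities (no monotonicity needed): the antipodal difference of `f − f_↓` at `γ` and at `M∖γ` contribute equally because `ĝ` is odd and the
level is even under `γ ↦ M∖γ` (`FK.apExpC_sdiff`, `FK.sum_powerset_flip`).  For increasing `f` the boundary factor `f(A) − f(A∖{e}) ≥ 0` is the indicator
that `e` is present and PIVOTAL; so the levelwise antipodal inequality (`C_∞⁺`) for `f` follows from the one for `f_↓` (which reads one edge fewer) as soon as
`Σ_{ℓ≤J, e pivotal, e∈γ} ĝ ≤ 0`, and from the one for `f_↑` as soon as `Σ_{ℓ≤J, e pivotal, e∉γ} ĝ ≥ 0` — the two certificates of the one-sided induction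
rule of memo FROM-fk-2-g34-SEPARATED-AND-RULES §4.1 (FK-Q2 §43), which in 75.5·10⁶ exact instances through 8 edges always has an admissible edge.
[cite: Grimmett2006, §1.4 eq. (1.20) (p. 15); §3.8 Thm. (3.90) (pp. 61–62)] [cite: Wagner2006, Thm. 5.8(d), §5.3]
-/

noncomputable section

namespace Summit.CriticalPhenomena.PercolationContinuityZ3.Theorems

namespace FK

open SimpleGraph Literature.Probability.LatticeModels Literature.Probability.Percolation
open scoped Classical

variable {V : Type*}

/-- **Generic coordinate split.**  For any `f, f'`: the levelwise antipodal sum for `f` equals the one for `f'` plus TWICE the one-sided sum of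
`(f − f')(γ ∪ C)·ĝ(γ)` (the term at `M∖γ` folds onto the term at `γ`). [cite: Grimmett2006, §3.8 Thm. (3.90) (pp. 61–62)] -/
theorem levels_sum_eq_add_two_sum (M C : Finset (Sym2 V)) (f f' g : Finset (Sym2 V) → ℝ) (J : ℕ) :
    ∑ γ ∈ M.powerset with apExpC M C γ ≤ J, (f (γ ∪ C) - f (M \ γ ∪ C)) * (g (γ ∪ C) - g (M \ γ ∪ C)) =
      ∑ γ ∈ M.powerset with apExpC M C γ ≤ J, (f' (γ ∪ C) - f' (M \ γ ∪ C)) * (g (γ ∪ C) - g (M \ γ ∪ C)) +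
        2 * ∑ γ ∈ M.powerset with apExpC M C γ ≤ J, (f (γ ∪ C) - f' (γ ∪ C)) * (g (γ ∪ C) - g (M \ γ ∪ C)) := by
  rw [Finset.sum_filter, Finset.sum_filter, Finset.sum_filter]
  -- the term at `M \ γ` equals the term at `γ`
  have hflip : ∑ γ ∈ M.powerset, (if apExpC M C γ ≤ J then
      (f (M \ γ ∪ C) - f' (M \ γ ∪ C)) * (g (γ ∪ C) - g (M \ γ ∪ C)) else 0) =
      -∑ γ ∈ M.powerset, (if apExpC M C γ ≤ J then (f (γ ∪ C) - f' (γ ∪ C)) * (g (γ ∪ C) - g (M \ γ ∪ C)) else 0) := by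
    rw [sum_powerset_flip M (fun γ => if apExpC M C γ ≤ J then
      (f (M \ γ ∪ C) - f' (M \ γ ∪ C)) * (g (γ ∪ C) - g (M \ γ ∪ C)) else 0), ← Finset.sum_neg_distrib]
    refine Finset.sum_congr rfl fun γ hγ => ?_
    have hγ' : γ ⊆ M := Finset.mem_powerset.1 hγ
    simp only [Finset.sdiff_sdiff_eq_self hγ', apExpC_sdiff M C hγ']
    split_ifs <;> ring
  have hpt : ∀ γ ∈ M.powerset, (if apExpC M C γ ≤ J then (f (γ ∪ C) - f (M \ γ ∪ C)) * (g (γ ∪ C) - g (M \ γ ∪ C)) else 0) =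
      (if apExpC M C γ ≤ J then (f' (γ ∪ C) - f' (M \ γ ∪ C)) * (g (γ ∪ C) - g (M \ γ ∪ C)) else 0) +
        ((if apExpC M C γ ≤ J then (f (γ ∪ C) - f' (γ ∪ C)) * (g (γ ∪ C) - g (M \ γ ∪ C)) else 0) -
          (if apExpC M C γ ≤ J then (f (M \ γ ∪ C) - f' (M \ γ ∪ C)) * (g (γ ∪ C) - g (M \ γ ∪ C)) else 0)) := by
    intro γ _
    split_ifs <;> ring
  rw [Finset.sum_congr rfl hpt, Finset.sum_add_distrib, Finset.sum_sub_distrib, hflip]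
  ring

/-- **Lowering split**: `f' = f ∘ (· \ {e})`; the boundary factor is `f(γ∪C) − f((γ∪C) \ {e})` (for increasing `f`: `≥ 0`, the indicator that `e` is present
and pivotal). [cite: Grimmett2006, §3.8 Thm. (3.90) (pp. 61–62)] -/
theorem levels_sum_eq_lower_add (M C : Finset (Sym2 V)) (f g : Finset (Sym2 V) → ℝ) (e : Sym2 V) (J : ℕ) :
    ∑ γ ∈ M.powerset with apExpC M C γ ≤ J, (f (γ ∪ C) - f (M \ γ ∪ C)) * (g (γ ∪ C) - g (M \ γ ∪ C)) =
      ∑ γ ∈ M.powerset with apExpC M C γ ≤ J,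
          (f ((γ ∪ C) \ {e}) - f ((M \ γ ∪ C) \ {e})) * (g (γ ∪ C) - g (M \ γ ∪ C)) +
        2 * ∑ γ ∈ M.powerset with apExpC M C γ ≤ J, (f (γ ∪ C) - f ((γ ∪ C) \ {e})) * (g (γ ∪ C) - g (M \ γ ∪ C)) :=
  levels_sum_eq_add_two_sum M C f (fun A => f (A \ {e})) g J

/-- **Raising split**: `f' = f ∘ insert e`; the boundary factor is `−(f(insert e (γ∪C)) − f(γ∪C))` (for increasing `f`: `≤ 0`, minus the indicator that
`e` is absent and pivotal). [cite: Grimmett2006, §3.8 Thm. (3.90) (pp. 61–62)] -/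
theorem levels_sum_eq_raise_sub (M C : Finset (Sym2 V)) (f g : Finset (Sym2 V) → ℝ) (e : Sym2 V) (J : ℕ) :
    ∑ γ ∈ M.powerset with apExpC M C γ ≤ J, (f (γ ∪ C) - f (M \ γ ∪ C)) * (g (γ ∪ C) - g (M \ γ ∪ C)) =
      ∑ γ ∈ M.powerset with apExpC M C γ ≤ J,
          (f (insert e (γ ∪ C)) - f (insert e (M \ γ ∪ C))) * (g (γ ∪ C) - g (M \ γ ∪ C)) -
        2 * ∑ γ ∈ M.powerset with apExpC M C γ ≤ J, (f (insert e (γ ∪ C)) - f (γ ∪ C)) * (g (γ ∪ C) - g (M \ γ ∪ C)) := by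
  rw [levels_sum_eq_add_two_sum M C f (fun A => f (insert e A)) g J, sub_eq_add_neg, ← mul_neg, ← Finset.sum_neg_distrib]
  congr 2
  exact Finset.sum_congr rfl fun γ _ => by ring

/-- **The lowering certificate.**  If the levelwise antipodal sum for `f ∘ (· \ {e})` is `≤ 0` and the `e`-present-pivotal boundary sum
`Σ_{ℓ≤J} (f(γ∪C) − f((γ∪C)\{e}))·ĝ(γ)` is `≤ 0`, then the levelwise antipodal sum for `f` is `≤ 0`. [cite: Grimmett2006, §3.8 Thm. (3.90) (pp. 61–62)] -/
theorem levels_le_of_lower (M C : Finset (Sym2 V)) (f g : Finset (Sym2 V) → ℝ) (e : Sym2 V) (J : ℕ)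
    (hlow : ∑ γ ∈ M.powerset with apExpC M C γ ≤ J,
      (f ((γ ∪ C) \ {e}) - f ((M \ γ ∪ C) \ {e})) * (g (γ ∪ C) - g (M \ γ ∪ C)) ≤ 0)
    (hcert : ∑ γ ∈ M.powerset with apExpC M C γ ≤ J, (f (γ ∪ C) - f ((γ ∪ C) \ {e})) * (g (γ ∪ C) - g (M \ γ ∪ C)) ≤ 0) :
    ∑ γ ∈ M.powerset with apExpC M C γ ≤ J, (f (γ ∪ C) - f (M \ γ ∪ C)) * (g (γ ∪ C) - g (M \ γ ∪ C)) ≤ 0 := by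
  rw [levels_sum_eq_lower_add M C f g e J]
  linarith

/-- **The raising certificate.**  If the levelwise antipodal sum for `f ∘ insert e` is `≤ 0` and the `e`-absent-pivotal boundary sum
`Σ_{ℓ≤J} (f(insert e (γ∪C)) − f(γ∪C))·ĝ(γ)` is `≥ 0`, then the levelwise antipodal sum for `f` is `≤ 0`. [cite: Grimmett2006, §3.8 Thm. (3.90) (pp. 61–62)] -/
theorem levels_le_of_raise (M C : Finset (Sym2 V)) (f g : Finset (Sym2 V) → ℝ) (e : Sym2 V) (J : ℕ)
    (hup : ∑ γ ∈ M.powerset with apExpC M C γ ≤ J,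
      (f (insert e (γ ∪ C)) - f (insert e (M \ γ ∪ C))) * (g (γ ∪ C) - g (M \ γ ∪ C)) ≤ 0)
    (hcert : 0 ≤ ∑ γ ∈ M.powerset with apExpC M C γ ≤ J, (f (insert e (γ ∪ C)) - f (γ ∪ C)) * (g (γ ∪ C) - g (M \ γ ∪ C))) :
    ∑ γ ∈ M.powerset with apExpC M C γ ≤ J, (f (γ ∪ C) - f (M \ γ ∪ C)) * (g (γ ∪ C) - g (M \ γ ∪ C)) ≤ 0 := by
  rw [levels_sum_eq_raise_sub M C f g e J]
  linarith

end FK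

end Summit.CriticalPhenomena.PercolationContinuityZ3.Theorems

end
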